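import Summits.HodgeConjecture.HodgeConjecture.Theorems.MarkmanPartnerTransportPicardThreeK3SquaresZeta11Type
import HarnessLib

/-!
# Route MarkmanPartnerTransport · crux `PicardThreeK3Squares` (stmt-HodgeConjecture-19652) —
# algebra of the ζ₁₁ model: `θ_ℂ = (g + g¹⁰)(1 - π_U)`, `g + g¹⁰` invertible, `ker θ_ℂ = U_ℂ`

Cell hodge-nonav, crux #4, INDEX row M-θ₁₁ (prover seat hodge-nonav-19652-p1 gen 13; `--supports
stmt-HodgeConjecture-19652`, helper). FACT-FREE linear algebra of an arbitrary datum `(g, u₁, u₂, y₀, θ)` of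
the named fact `VanGeemenSchuett2025_OguisoZhang2011_zeta11_cycleOnOpenPeriodSet` (an integral isometry `g`
of the K3 lattice of order `11` fixing the hyperbolic plane `U = ℤu₁ ⊕ ℤu₂`, and `θ_ℂ = (g + g¹⁰) - 2π_U`),
preparing the hypothesis-minimal form of `hodgeConjectureFor_square_of_zeta11Type` (companion file
`…Zeta11TypeOfConj`). NO base-change theory is used (the integral fixed-lattice clause is not needed here):

* `piU_apply`, `piU_apply_u1/u2`, `piU_mul_piU`, `g_mul_piU`, `piU_mul_g` — `π_U y = (y.u₂)u₁ + (y.u₁)u₂`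
  is an idempotent commuting with `g` and fixing `u₁, u₂`;
* `thetaC_eq_of_zeta11Model` — `θ_ℂ = g + g¹⁰ - 2π_U`; `thetaC_mul_piU`, `piU_mul_thetaC` — `θ_ℂπ_U = π_Uθ_ℂ = 0`;
  **`thetaC_eq_mul_one_sub_piU`** — `θ_ℂ = (g + g¹⁰)(1 - π_U) = (1 - π_U)(g + g¹⁰)`;
* **`aeval_inv_mul_add_pow_ten`** — `p₂(g)·(g + g¹⁰) = 2` for the explicit `p₂ ∈ ℤ[X]`
  (`(X + X¹⁰)p₂ = 2 + (X¹¹ - 1)q₂`): `g + g¹⁰` is INVERTIBLE (its eigenvalues are `2cos(2πk/11) ≠ 0`, `11` odd);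
* **`thetaC_apply_eq_zero_iff`** — `θ_ℂ y = 0 ↔ π_U y = y`; **`ker_thetaC_eq_span_of_zeta11Model`** —
  `ker θ_ℂ = ℂu₁ ⊕ ℂu₂`; `ker_thetaC_le_span_ratCast_of_zeta11Model` (rationally spanned);
  **`finrank_ker_thetaC_of_zeta11Model`** — `dim ker θ_ℂ = 2`;
* **`aeval_add_pow_ten_sextic`** — `Q(g + g¹⁰) = 0` for `Q = (X - 2)·P₁₁`, `P₁₁ = X⁵ + X⁴ - 4X³ - 3X² + 3X + 1`
  the minimal polynomial of `ζ₁₁ + ζ₁₁⁻¹` (identity `Q(X + X¹⁰) = (X¹¹ - 1)·R(X)` in `ℤ[X]`);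
  `aeval_thetaC_sextic_apply_of_piU_eq_zero` — hence `Q(θ_ℂ) v = 0` for every `v` with `π_U v = 0`.

No definition, no sorry, no named fact. References: van Geemen–Schütt, Forum Math. Sigma 13 (2025) e2, §2.1,
§4.8, Thm. 1.1 (11); Oguiso–Zhang, PAMQ 7 (2011), Thm. 1.5.
-/

set_option linter.dupNamespace false

noncomputable section

namespace Summit.HodgeConjecture.HodgeConjecture.Theorems.MarkmanPartnerTransport.RMTypeOrbit

open CategoryTheory MonoidalCategory Polynomial
open Literature.AlgebraicGeometry Literature.AlgebraicGeometry.Motives Literature.AlgebraicGeometry.HodgeTheory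
open Literature.AlgebraicGeometry.Surfaces Literature.LinearAlgebra.QuadraticForm
open Literature.AlgebraicTopology.SingularHomology
open Summit.HodgeConjecture.HodgeConjecture.Theorems.NikulinTwinTransport
open Summit.HodgeConjecture.HodgeConjecture.Theorems.MarkmanPartnerTransport.IsogenyInvariance
open Summit.HodgeConjecture.HodgeConjecture.Theorems.MarkmanPartnerTransport.RMTypeDescent

/-- `Zeta11Model[g, u₁, u₂, y₀, θ]`: VERBATIM the antecedents of the named fact
`VanGeemenSchuett2025_OguisoZhang2011_zeta11_cycleOnOpenPeriodSet` (as in `…PicardThreeK3SquaresZeta11Type`).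
Local notation only. -/
local notation3 (prettyPrint := false) "Zeta11Model[" g ", " u₁ ", " u₂ ", " y₀ ", " θ "]" =>
  ((∀ a b : K3Index → ℂ, k3Form (g a) (g b) = k3Form a b) ∧
    (∀ v : K3Index → ℤ, ∃ w : K3Index → ℤ,
      g (fun i => ((v i : ℤ) : ℂ)) = fun i => ((w i : ℤ) : ℂ)) ∧
    g ^ 11 = 1 ∧
    g (fun i => ((u₁ i : ℤ) : ℂ)) = (fun i => ((u₁ i : ℤ) : ℂ)) ∧
    g (fun i => ((u₂ i : ℤ) : ℂ)) = (fun i => ((u₂ i : ℤ) : ℂ)) ∧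
    k3Form (fun i => ((u₁ i : ℤ) : ℂ)) (fun i => ((u₁ i : ℤ) : ℂ)) = 0 ∧
    k3Form (fun i => ((u₂ i : ℤ) : ℂ)) (fun i => ((u₂ i : ℤ) : ℂ)) = 0 ∧
    k3Form (fun i => ((u₁ i : ℤ) : ℂ)) (fun i => ((u₂ i : ℤ) : ℂ)) = 1 ∧
    (∀ v : K3Index → ℤ, g (fun i => ((v i : ℤ) : ℂ)) = (fun i => ((v i : ℤ) : ℂ)) →
      ∃ m n : ℤ, v = m • u₁ + n • u₂) ∧
    k3Form y₀ y₀ = 0 ∧ 0 < (k3Form (star y₀) y₀).re ∧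
    g y₀ = Complex.exp (2 * Real.pi * Complex.I / 11) • y₀ ∧
    (∀ y : K3Index → ℂ, thetaC θ y =
      g y + (g ^ 10) y - (2 * k3Form y (fun i => ((u₂ i : ℤ) : ℂ))) • (fun i => ((u₁ i : ℤ) : ℂ))
        - (2 * k3Form y (fun i => ((u₁ i : ℤ) : ℂ))) • (fun i => ((u₂ i : ℤ) : ℂ))))

/-- `𝓲(u)`: the integral lattice vector `u ∈ Λ` read in `Λ_ℂ`. Local notation only. -/
local notation3 (prettyPrint := false) "𝓲(" u ")" => (fun i : K3Index => ((u i : ℤ) : ℂ))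

/-- `πU[u₁, u₂]`: the `k3Form`-orthogonal projector `y ↦ (y.u₂)u₁ + (y.u₁)u₂` onto the hyperbolic plane
`ℂu₁ ⊕ ℂu₂` (for `(u₁.u₁) = (u₂.u₂) = 0`, `(u₁.u₂) = 1`). Local notation only. -/
local notation3 (prettyPrint := false) "πU[" u₁ ", " u₂ "]" =>
  ((LinearMap.smulRight (k3FormC (fun i : K3Index => ((u₂ i : ℤ) : ℂ))) (fun i : K3Index => ((u₁ i : ℤ) : ℂ)) +
      LinearMap.smulRight (k3FormC (fun i : K3Index => ((u₁ i : ℤ) : ℂ))) (fun i : K3Index => ((u₂ i : ℤ) : ℂ)) :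
    Module.End ℂ (K3Index → ℂ)))

/-- `P₂ = -1 + X + X² - X³ - X⁴ + X⁵ + X⁶ - X⁷ - X⁸ + X⁹ + X¹⁰`: twice the inverse of `X + X¹⁰` modulo `X¹¹ - 1`.
Local notation only. -/
local notation3 (prettyPrint := false) "P₂" =>
  (-1 + X + X ^ 2 - X ^ 3 - X ^ 4 + X ^ 5 + X ^ 6 - X ^ 7 - X ^ 8 + X ^ 9 + X ^ 10 : ℂ[X])

/-- `Q₁₁ = (X - 2)(X⁵ + X⁴ - 4X³ - 3X² + 3X + 1) ∈ ℚ[X]`: `X - 2` times the minimal polynomial of `ζ₁₁ + ζ₁₁⁻¹`.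
Local notation only. -/
local notation3 (prettyPrint := false) "Q₁₁" =>
  ((X - C (2 : ℚ)) * (X ^ 5 + X ^ 4 - C (4 : ℚ) * X ^ 3 - C (3 : ℚ) * X ^ 2 + C (3 : ℚ) * X + 1) : ℚ[X])

variable {g : Module.End ℂ (K3Index → ℂ)} {u₁ u₂ : K3Index → ℤ} {y₀ : K3Index → ℂ}
  {θ : Matrix K3Index K3Index ℚ}

/-! ### The projector `π_U` -/

/-- `π_U y = (y.u₂)u₁ + (y.u₁)u₂`. [folklore] -/
theorem piU_apply (u₁ u₂ : K3Index → ℤ) (y : K3Index → ℂ) :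
    πU[u₁, u₂] y = k3Form y 𝓲(u₂) • 𝓲(u₁) + k3Form y 𝓲(u₁) • 𝓲(u₂) := by
  simp only [LinearMap.add_apply, LinearMap.smulRight_apply, k3FormC_apply]
  rw [k3Form_comm _ y, k3Form_comm 𝓲(u₁) y]

/-- `θ_ℂ = g + g¹⁰ - 2π_U` for a ζ₁₁ datum. [cite: GeemenSchutt2023, §4.8] -/
theorem thetaC_eq_of_zeta11Model (hZ : Zeta11Model[g, u₁, u₂, y₀, θ]) :
    thetaC θ = g + g ^ 10 - (2 : ℂ) • πU[u₁, u₂] := by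
  have hθ := hZ.2.2.2.2.2.2.2.2.2.2.2.2
  refine LinearMap.ext fun y => ?_
  rw [hθ y, LinearMap.sub_apply, LinearMap.add_apply, LinearMap.smul_apply, piU_apply, smul_add, smul_smul,
    smul_smul]
  abel

/-- `π_U u₁ = u₁`. [folklore] -/
theorem piU_apply_u1 (hZ : Zeta11Model[g, u₁, u₂, y₀, θ]) : πU[u₁, u₂] 𝓲(u₁) = 𝓲(u₁) := by
  obtain ⟨-, -, -, -, -, hu₁₁, -, hu₁₂, -⟩ := hZ
  rw [piU_apply, hu₁₂, hu₁₁, one_smul, zero_smul, add_zero]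

/-- `π_U u₂ = u₂`. [folklore] -/
theorem piU_apply_u2 (hZ : Zeta11Model[g, u₁, u₂, y₀, θ]) : πU[u₁, u₂] 𝓲(u₂) = 𝓲(u₂) := by
  obtain ⟨-, -, -, -, -, -, hu₂₂, hu₁₂, -⟩ := hZ
  rw [piU_apply, hu₂₂, k3Form_comm, hu₁₂, zero_smul, one_smul, zero_add]

/-- `π_U² = π_U`. [folklore] -/
theorem piU_mul_piU (hZ : Zeta11Model[g, u₁, u₂, y₀, θ]) : πU[u₁, u₂] * πU[u₁, u₂] = πU[u₁, u₂] := by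
  refine LinearMap.ext fun y => ?_
  rw [Module.End.mul_apply, piU_apply u₁ u₂ y, map_add, map_smul, map_smul, piU_apply_u1 hZ, piU_apply_u2 hZ]

/-- `g ∘ π_U = π_U` (`g` fixes `u₁, u₂`). [folklore] -/
theorem g_mul_piU (hZ : Zeta11Model[g, u₁, u₂, y₀, θ]) : g * πU[u₁, u₂] = πU[u₁, u₂] := by
  obtain ⟨-, -, -, hgu₁, hgu₂, -⟩ := hZ
  refine LinearMap.ext fun y => ?_
  rw [Module.End.mul_apply, piU_apply, map_add, map_smul, map_smul, hgu₁, hgu₂]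

/-- `gᵏ ∘ π_U = π_U`. [folklore] -/
theorem g_pow_mul_piU (hZ : Zeta11Model[g, u₁, u₂, y₀, θ]) (k : ℕ) : g ^ k * πU[u₁, u₂] = πU[u₁, u₂] := by
  induction k with
  | zero => rw [pow_zero, one_mul]
  | succ k ih => rw [pow_succ, mul_assoc, g_mul_piU hZ, ih]

/-- `π_U ∘ g = π_U` (`g` is an isometry fixing `u₁, u₂`). [folklore] -/
theorem piU_mul_g (hZ : Zeta11Model[g, u₁, u₂, y₀, θ]) : πU[u₁, u₂] * g = πU[u₁, u₂] := by
  obtain ⟨hg, -, -, hgu₁, hgu₂, -⟩ := hZ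
  refine LinearMap.ext fun y => ?_
  have h1 : k3Form (g y) 𝓲(u₁) = k3Form y 𝓲(u₁) := by
    conv_lhs => rw [← hgu₁]
    exact hg y _
  have h2 : k3Form (g y) 𝓲(u₂) = k3Form y 𝓲(u₂) := by
    conv_lhs => rw [← hgu₂]
    exact hg y _
  rw [Module.End.mul_apply, piU_apply, piU_apply, h1, h2]

/-- `π_U ∘ gᵏ = π_U`. [folklore] -/
theorem piU_mul_g_pow (hZ : Zeta11Model[g, u₁, u₂, y₀, θ]) (k : ℕ) : πU[u₁, u₂] * g ^ k = πU[u₁, u₂] := by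
  induction k with
  | zero => rw [pow_zero, mul_one]
  | succ k ih => rw [pow_succ', ← mul_assoc, piU_mul_g hZ, ih]

/-! ### `θ_ℂ = (g + g¹⁰)(1 - π_U)` -/

/-- `θ_ℂ ∘ π_U = 0`: `θ_ℂ` kills the plane `ℂu₁ ⊕ ℂu₂`. [cite: GeemenSchutt2023, §2.1] -/
theorem thetaC_mul_piU (hZ : Zeta11Model[g, u₁, u₂, y₀, θ]) : thetaC θ * πU[u₁, u₂] = 0 := by
  rw [thetaC_eq_of_zeta11Model hZ, sub_mul, add_mul, g_mul_piU hZ, g_pow_mul_piU hZ, smul_mul_assoc,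
    piU_mul_piU hZ, two_smul, sub_self]

/-- `π_U ∘ θ_ℂ = 0`. [cite: GeemenSchutt2023, §2.1] -/
theorem piU_mul_thetaC (hZ : Zeta11Model[g, u₁, u₂, y₀, θ]) : πU[u₁, u₂] * thetaC θ = 0 := by
  rw [thetaC_eq_of_zeta11Model hZ, mul_sub, mul_add, piU_mul_g hZ, piU_mul_g_pow hZ, mul_smul_comm,
    piU_mul_piU hZ, two_smul, sub_self]

/-- **`θ_ℂ = (g + g¹⁰) ∘ (1 - π_U)`.** [cite: GeemenSchutt2023, §2.1 and §4.8] -/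
theorem thetaC_eq_mul_one_sub_piU (hZ : Zeta11Model[g, u₁, u₂, y₀, θ]) :
    thetaC θ = (g + g ^ 10) * (1 - πU[u₁, u₂]) := by
  rw [mul_sub, mul_one, add_mul, g_mul_piU hZ, g_pow_mul_piU hZ, thetaC_eq_of_zeta11Model hZ, two_smul]

/-- `θ_ℂ = (1 - π_U) ∘ (g + g¹⁰)`. [cite: GeemenSchutt2023, §2.1 and §4.8] -/
theorem thetaC_eq_one_sub_piU_mul (hZ : Zeta11Model[g, u₁, u₂, y₀, θ]) :
    thetaC θ = (1 - πU[u₁, u₂]) * (g + g ^ 10) := by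
  rw [sub_mul, one_mul, mul_add, piU_mul_g hZ, piU_mul_g_pow hZ, thetaC_eq_of_zeta11Model hZ, two_smul]

/-- `θ_ℂ v = (g + g¹⁰) v` whenever `π_U v = 0`. [folklore] -/
theorem thetaC_apply_of_piU_eq_zero (hZ : Zeta11Model[g, u₁, u₂, y₀, θ]) {v : K3Index → ℂ}
    (hv : πU[u₁, u₂] v = 0) : thetaC θ v = (g + g ^ 10) v := by
  rw [thetaC_eq_mul_one_sub_piU hZ, Module.End.mul_apply, LinearMap.sub_apply, Module.End.one_apply, hv,
    sub_zero]

/-! ### `g + g¹⁰` is invertible -/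

/-- **`p₂(g) ∘ (g + g¹⁰) = 2`** with `p₂ = -1 + X + X² - X³ - X⁴ + X⁵ + X⁶ - X⁷ - X⁸ + X⁹ + X¹⁰`, for `g¹¹ = 1`
(`(X + X¹⁰)·p₂ = 2 + (X¹¹ - 1)·(2 + X - X² - X³ + X⁴ + X⁵ - X⁶ - X⁷ + X⁸ + X⁹)`): `g + g¹⁰ = g + g⁻¹` is
invertible. [folklore] -/
theorem aeval_inv_mul_add_pow_ten (hg11 : g ^ 11 = 1) :
    aeval g P₂ * (g + g ^ 10) = (2 : ℂ) • (1 : Module.End ℂ (K3Index → ℂ)) := by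
  have hpoly : (P₂ * (X + X ^ 10) : ℂ[X]) =
      C (2 : ℂ) + (X ^ 11 - 1) * (2 + X - X ^ 2 - X ^ 3 + X ^ 4 + X ^ 5 - X ^ 6 - X ^ 7 + X ^ 8 + X ^ 9) := by
    rw [show (C (2 : ℂ) : ℂ[X]) = 2 from map_ofNat C 2]
    ring
  have h := congrArg (Polynomial.aeval g) hpoly
  have e1 : aeval g (X + X ^ 10 : ℂ[X]) = g + g ^ 10 := by
    rw [map_add, map_pow, aeval_X]
  have e2 : aeval g (C (2 : ℂ) + (X ^ 11 - 1) *
      (2 + X - X ^ 2 - X ^ 3 + X ^ 4 + X ^ 5 - X ^ 6 - X ^ 7 + X ^ 8 + X ^ 9) : ℂ[X]) =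
      (2 : ℂ) • (1 : Module.End ℂ (K3Index → ℂ)) := by
    rw [map_add, aeval_C, Algebra.algebraMap_eq_smul_one, map_mul, map_sub, map_pow, aeval_X, map_one, hg11,
      sub_self, zero_mul, add_zero]
  rw [map_mul, e1, e2] at h
  exact h

/-- `g + g¹⁰` is injective (`g¹¹ = 1`). [folklore] -/
theorem eq_zero_of_add_pow_ten_apply_eq_zero (hg11 : g ^ 11 = 1) {z : K3Index → ℂ}
    (hz : (g + g ^ 10) z = 0) : z = 0 := by
  have h := congrArg (fun f : Module.End ℂ (K3Index → ℂ) => f z) (aeval_inv_mul_add_pow_ten hg11)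
  simp only [Module.End.mul_apply, hz, map_zero, LinearMap.smul_apply, Module.End.one_apply] at h
  exact (smul_eq_zero.1 h.symm).resolve_left two_ne_zero

/-! ### `ker θ_ℂ = ℂu₁ ⊕ ℂu₂` -/

/-- **`θ_ℂ y = 0 ↔ π_U y = y`.** (`⇒`: `(g + g¹⁰)((1 - π_U)y) = 0` and `g + g¹⁰` is injective; `⇐`: `θ_ℂπ_U = 0`.)
[folklore] -/
theorem thetaC_apply_eq_zero_iff (hZ : Zeta11Model[g, u₁, u₂, y₀, θ]) (y : K3Index → ℂ) :
    thetaC θ y = 0 ↔ πU[u₁, u₂] y = y := by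
  constructor
  · intro hy
    rw [thetaC_eq_mul_one_sub_piU hZ, Module.End.mul_apply] at hy
    have h := eq_zero_of_add_pow_ten_apply_eq_zero hZ.2.2.1 hy
    rw [LinearMap.sub_apply, Module.End.one_apply, sub_eq_zero] at h
    exact h.symm
  · intro hy
    rw [← hy, ← Module.End.mul_apply, thetaC_mul_piU hZ, LinearMap.zero_apply]

/-- `θ_ℂ u₁ = 0`. [folklore] -/
theorem thetaC_u1 (hZ : Zeta11Model[g, u₁, u₂, y₀, θ]) : thetaC θ 𝓲(u₁) = 0 :=
  (thetaC_apply_eq_zero_iff hZ _).2 (piU_apply_u1 hZ)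

/-- `θ_ℂ u₂ = 0`. [folklore] -/
theorem thetaC_u2 (hZ : Zeta11Model[g, u₁, u₂, y₀, θ]) : thetaC θ 𝓲(u₂) = 0 :=
  (thetaC_apply_eq_zero_iff hZ _).2 (piU_apply_u2 hZ)

/-- `u₁, u₂` are linearly independent in `Λ_ℂ` (`(u₁.u₁) = 0`, `(u₁.u₂) = 1`, `(u₂.u₂) = 0`). [folklore] -/
theorem linearIndependent_u1_u2 (hZ : Zeta11Model[g, u₁, u₂, y₀, θ]) : LinearIndependent ℂ ![𝓲(u₁), 𝓲(u₂)] := by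
  obtain ⟨-, -, -, -, -, hu₁₁, hu₂₂, hu₁₂, -⟩ := hZ
  refine LinearIndependent.pair_iff.2 fun s t hst => ?_
  have h1 := congrArg (fun v => k3Form v 𝓲(u₁)) hst
  have h2 := congrArg (fun v => k3Form v 𝓲(u₂)) hst
  simp only [k3Form_add_left, k3Form_smul_left, k3Form_zero_left, hu₁₁, hu₁₂, hu₂₂, k3Form_comm 𝓲(u₂) 𝓲(u₁)]
    at h1 h2
  constructor
  · simpa using h2
  · simpa using h1

/-- **`ker θ_ℂ = ℂu₁ ⊕ ℂu₂`** for a ζ₁₁ datum. [cite: GeemenSchutt2023, §2.1 and Thm. 1.1 (11)] -/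
theorem ker_thetaC_eq_span_of_zeta11Model (hZ : Zeta11Model[g, u₁, u₂, y₀, θ]) :
    LinearMap.ker (thetaC θ) = Submodule.span ℂ (Set.range ![𝓲(u₁), 𝓲(u₂)]) := by
  refine le_antisymm ?_ ?_
  · intro y hy
    rw [LinearMap.mem_ker, thetaC_apply_eq_zero_iff hZ] at hy
    rw [← hy, piU_apply]
    refine Submodule.add_mem _ (Submodule.smul_mem _ _ (Submodule.subset_span ⟨0, ?_⟩))
      (Submodule.smul_mem _ _ (Submodule.subset_span ⟨1, ?_⟩)) <;> simp
  · rw [Submodule.span_le]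
    rintro w ⟨i, rfl⟩
    fin_cases i
    · exact thetaC_u1 hZ
    · exact thetaC_u2 hZ

/-- `ker θ_ℂ` is spanned by RATIONAL vectors (`u₁`, `u₂`). [folklore] -/
theorem ker_thetaC_le_span_ratCast_of_zeta11Model (hZ : Zeta11Model[g, u₁, u₂, y₀, θ]) :
    LinearMap.ker (thetaC θ) ≤
      Submodule.span ℂ {w : K3Index → ℂ | (∃ q : K3Index → ℚ, w = fun i => (q i : ℂ)) ∧ thetaC θ w = 0} := by
  rw [ker_thetaC_eq_span_of_zeta11Model hZ]
  refine Submodule.span_mono ?_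
  rintro w ⟨i, rfl⟩
  fin_cases i
  · exact ⟨⟨fun j => (u₁ j : ℚ), funext fun j => by simp⟩, thetaC_u1 hZ⟩
  · exact ⟨⟨fun j => (u₂ j : ℚ), funext fun j => by simp⟩, thetaC_u2 hZ⟩

/-- **`dim_ℂ ker θ_ℂ = 2`** for a ζ₁₁ datum. [cite: GeemenSchutt2023, Thm. 1.1 (11)] -/
theorem finrank_ker_thetaC_of_zeta11Model (hZ : Zeta11Model[g, u₁, u₂, y₀, θ]) :
    Module.finrank ℂ (LinearMap.ker (thetaC θ)) = 2 := by
  rw [ker_thetaC_eq_span_of_zeta11Model hZ, finrank_span_eq_card (linearIndependent_u1_u2 hZ)]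
  simp

/-! ### The sextic `(X - 2)·P₁₁` annihilates `g + g¹⁰` -/

/-- `Q₁₁(f) = (f - 2)(f⁵ + f⁴ - 4f³ - 3f² + 3f + 1)` for an endomorphism `f`. [folklore] -/
theorem aeval_sextic_map_eq {V : Type*} [AddCommGroup V] [Module ℂ V] (f : Module.End ℂ V) :
    aeval f ((Q₁₁).map (algebraMap ℚ ℂ)) =
      (f - (2 : ℂ) • 1) * (f ^ 5 + f ^ 4 - (4 : ℂ) • f ^ 3 - (3 : ℂ) • f ^ 2 + (3 : ℂ) • f + 1) := by
  simp only [Polynomial.map_add, Polynomial.map_sub, Polynomial.map_mul, Polynomial.map_pow,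
    Polynomial.map_X, Polynomial.map_C, Polynomial.map_one, map_add, map_sub, map_mul, map_pow,
    Polynomial.aeval_X, Polynomial.aeval_C, map_one, Algebra.algebraMap_eq_smul_one, smul_mul_assoc,
    one_mul]
  rw [Rat.smul_one_eq_cast, Rat.smul_one_eq_cast, Rat.smul_one_eq_cast, Rat.cast_ofNat, Rat.cast_ofNat,
    Rat.cast_ofNat]

/-- `Q₁₁` over `ℂ`, explicitly. [folklore] -/
theorem sextic_map_eq :
    (Q₁₁).map (algebraMap ℚ ℂ) = ((X - 2) * (X ^ 5 + X ^ 4 - 4 * X ^ 3 - 3 * X ^ 2 + 3 * X + 1) : ℂ[X]) := by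
  simp only [Polynomial.map_add, Polynomial.map_sub, Polynomial.map_mul, Polynomial.map_pow,
    Polynomial.map_X, Polynomial.map_one, map_ofNat, Polynomial.map_ofNat]

/-- **`Q₁₁(g + g¹⁰) = 0` for `g¹¹ = 1`**, `Q₁₁ = (X - 2)(X⁵ + X⁴ - 4X³ - 3X² + 3X + 1)`: the polynomial identity
`Q₁₁(X + X¹⁰) = (X¹¹ - 1)·R(X)` in `ℤ[X]` (`X⁵P₁₁(X + X⁻¹) = Φ₁₁(X)`, `X(X + X⁻¹ - 2) = (X - 1)²`,
`(X - 1)Φ₁₁ = X¹¹ - 1`). [cite: GeemenSchutt2023, Thm. 1.1 (11)] -/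
theorem aeval_add_pow_ten_sextic (hg11 : g ^ 11 = 1) :
    aeval (g + g ^ 10) ((Q₁₁).map (algebraMap ℚ ℂ)) = 0 := by
  have hcomp : ((Q₁₁).map (algebraMap ℚ ℂ)).comp (X + X ^ 10) =
      (X ^ 11 - 1) * (2 + 5 * X - 9 * X ^ 2 - 5 * X ^ 3 + 6 * X ^ 4 + X ^ 5 - X ^ 6 + 5 * X ^ 10 - 16 * X ^ 11
        - 10 * X ^ 12 + 15 * X ^ 13 + X ^ 16 - X ^ 17 - 9 * X ^ 20 - 10 * X ^ 21 + 20 * X ^ 22 + X ^ 27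
        - X ^ 28 - 5 * X ^ 30 + 15 * X ^ 31 + X ^ 38 - X ^ 39 + 6 * X ^ 40 + X ^ 49 : ℂ[X]) := by
    rw [sextic_map_eq]
    simp only [Polynomial.mul_comp, Polynomial.sub_comp, Polynomial.add_comp, Polynomial.pow_comp,
      Polynomial.X_comp, Polynomial.ofNat_comp, Polynomial.one_comp, Nat.cast_ofNat]
    ring
  have e1 : aeval g (X + X ^ 10 : ℂ[X]) = g + g ^ 10 := by
    rw [map_add, map_pow, aeval_X]
  rw [← e1, ← Polynomial.aeval_comp, hcomp, map_mul, map_sub, map_pow, aeval_X, map_one, hg11, sub_self,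
    zero_mul]

/-- `gᵏ ∘ (1 - π_U) = (1 - π_U) ∘ gᵏ`-type bookkeeping: `(g + g¹⁰)` commutes with `1 - π_U`. [folklore] -/
theorem add_pow_ten_mul_one_sub_piU (hZ : Zeta11Model[g, u₁, u₂, y₀, θ]) :
    (g + g ^ 10) * (1 - πU[u₁, u₂]) = (1 - πU[u₁, u₂]) * (g + g ^ 10) := by
  rw [← thetaC_eq_mul_one_sub_piU hZ, thetaC_eq_one_sub_piU_mul hZ]

/-- `θ_ℂᵏ ∘ (1 - π_U) = (g + g¹⁰)ᵏ ∘ (1 - π_U)`. [folklore] -/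
theorem thetaC_pow_mul_one_sub_piU (hZ : Zeta11Model[g, u₁, u₂, y₀, θ]) (k : ℕ) :
    thetaC θ ^ k * (1 - πU[u₁, u₂]) = (g + g ^ 10) ^ k * (1 - πU[u₁, u₂]) := by
  have hidem : (1 - πU[u₁, u₂]) * (1 - πU[u₁, u₂]) = 1 - πU[u₁, u₂] := by
    rw [mul_sub, mul_one, sub_mul, one_mul, piU_mul_piU hZ, sub_self, sub_zero]
  have hθE : thetaC θ * (1 - πU[u₁, u₂]) = (g + g ^ 10) * (1 - πU[u₁, u₂]) := by
    rw [thetaC_eq_mul_one_sub_piU hZ, mul_assoc, hidem]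
  have hcomm := add_pow_ten_mul_one_sub_piU hZ
  induction k with
  | zero => rw [pow_zero, pow_zero]
  | succ k ih =>
    calc thetaC θ ^ (k + 1) * (1 - πU[u₁, u₂])
        = thetaC θ ^ k * (thetaC θ * (1 - πU[u₁, u₂])) := by rw [pow_succ, mul_assoc]
      _ = thetaC θ ^ k * (1 - πU[u₁, u₂]) * (g + g ^ 10) := by rw [hθE, hcomm, mul_assoc]
      _ = (g + g ^ 10) ^ k * (1 - πU[u₁, u₂]) * (g + g ^ 10) := by rw [ih]
      _ = (g + g ^ 10) ^ (k + 1) * (1 - πU[u₁, u₂]) := by rw [mul_assoc, ← hcomm, ← mul_assoc, ← pow_succ]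

/-- `Q(θ_ℂ) ∘ (1 - π_U) = Q(g + g¹⁰) ∘ (1 - π_U)` for every `Q ∈ ℂ[X]`. [folklore] -/
theorem aeval_thetaC_mul_one_sub_piU (hZ : Zeta11Model[g, u₁, u₂, y₀, θ]) (Q : ℂ[X]) :
    aeval (thetaC θ) Q * (1 - πU[u₁, u₂]) = aeval (g + g ^ 10) Q * (1 - πU[u₁, u₂]) := by
  rw [Polynomial.aeval_eq_sum_range, Polynomial.aeval_eq_sum_range, Finset.sum_mul, Finset.sum_mul]
  refine Finset.sum_congr rfl fun k _ => ?_
  rw [smul_mul_assoc, smul_mul_assoc, thetaC_pow_mul_one_sub_piU hZ]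

/-- **`Q₁₁(θ_ℂ) v = 0` whenever `π_U v = 0`** (i.e. for `v ⊥ ℂu₁ ⊕ ℂu₂`), `Q₁₁ = (X - 2)·P₁₁`.
[cite: GeemenSchutt2023, Thm. 1.1 (11) and §2.1] -/
theorem aeval_thetaC_sextic_apply_of_piU_eq_zero (hZ : Zeta11Model[g, u₁, u₂, y₀, θ]) {v : K3Index → ℂ}
    (hv : πU[u₁, u₂] v = 0) : aeval (thetaC θ) ((Q₁₁).map (algebraMap ℚ ℂ)) v = 0 := by
  have h1 : (1 - πU[u₁, u₂]) v = v := by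
    rw [LinearMap.sub_apply, Module.End.one_apply, hv, sub_zero]
  rw [← h1, ← Module.End.mul_apply, aeval_thetaC_mul_one_sub_piU hZ, aeval_add_pow_ten_sextic hZ.2.2.1,
    zero_mul, LinearMap.zero_apply]

end Summit.HodgeConjecture.HodgeConjecture.Theorems.MarkmanPartnerTransport.RMTypeOrbit

end
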